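import Summits.NavierStokesRegularity.FluidComputer.PalasekTowerHeredityWitnessWindow
import Summits.NavierStokesRegularity.FluidComputer.PalasekTowerHeredityWitnessTower

/-!
# REGISTER v2.3′: the heredity witness — a WINDOW LADDER of one design realises the tower

Cell `ns-blowup`, seat `ns-blowup-ecbridge-6` (g3; D-0074 GROUP C «BRIDGE SUPPORT»; bears_on LADDER-NS N1,
route `PalasekTowerBreakdown` — the TARGET side: Clay (C) `NavierStokesBreakdownR3` from a typed
numerical-witness hypothesis read for ONE design at ALL levels; beside the ∀-cruxes 19178/19179, implies
neither; supports only, nothing claimed). Sequel of `PalasekTowerHeredityWitnessTower.lean` (p425922: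
ONE design's certificate ladder in DATUM form — a registered level-`0` stage and a `LevelWitness` at
every level, each re-running the flow from `t = 0` — realises the tower and gives (C) with no named
fact) and of `PalasekTowerHeredityWitnessWindow.lean` (p433214: one WINDOW run from a registered
stage's own state extends the stage). LABEL: E–C typing (KERNEL plumbing; theorems only, no definition,
no named fact). WHAT THIS IS NOT: not Navier–Stokes evidence — CONDITIONAL on a window ladder nobody has
and nobody asserts; no stage, flow, tower or blow-up is constructed; MODEL tower runs are ANALOGUES of
the window runs, never instances (HOME/cap/K1R-CAP-PRICE.md).

* `Schedule.nonempty_stage_of_window_solutions` — any rates, any `ν > 0`: a registered level-`0` stage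
  of the design `S` plus, for EVERY registered stage `s` of `S` at EVERY level `k`, ONE window run (a
  classical solution of `(ν, S.f)` on `[τ k - ε, τ (k+1)]` from `s.u (τ k - ε)`, some `0 < ε ≤ τ k`,
  finite energy, ceiling `c₂ Y_{k+1}` on the window, three level-`k+1` floors at `τ (k+1)`) ⇒ a
  registered stage of `S` at every level (induction on the level with
  `Stage.exists_extends_of_window_solution`);
* `palasekStep2_of_window_solutions`, **`navierStokesBreakdownR3_of_window_solutions`** — hence
  Palasek's Step 2 and Fefferman's (C) (through p425922's `navierStokesBreakdownR3_of_nonempty_stages`,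
  i.e. lean g4's W14-free bridge `navierStokesBreakdownR3_of_step2_B`): THE TOWER AS A SEQUENCE OF
  RESTARTED INITIAL-VALUE RUNS OF ONE DESIGN, each launched from the previous certified state, none
  re-running the history. Conditional on the ladder; credits nothing.

References: S. Palasek, arXiv:2605.13827 §4 («Step 2») [cite: Palasek2026ElementaryModel, §4];
C. L. Fefferman, Clay problem description, (C) [cite: FeffermanClay2006, (C)]; H. Sohr, *The
Navier–Stokes Equations*, Birkhäuser 2001, Ch. V Thm. 1.5.1 [cite: Sohr2001, Ch. V Thm. 1.5.1].
-/

noncomputable section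

namespace Summit.NavierStokesRegularity.FluidComputer.PalasekTowerClayBridge

open Set MeasureTheory Filter Topology Function Real
open scoped ENNReal ContDiff NNReal
open Literature.Analysis.FluidPDE

namespace Schedule

variable {ν : ℝ} {R : TowerRates} (S : Schedule R)

/-- **A window ladder gives a registered stage at every level** (any rates, any `ν > 0`): a registered
(routeG) level-`0` stage of the design `S` and, for every registered stage `s` of `S` at every level
`k`, one window run from its own state — a classical solution of `(ν, S.f)` on `[τ k - ε, τ (k+1)]`
(some `0 < ε ≤ τ k`) with `v (τ k - ε) = s.u (τ k - ε)`, finite energy, `‖v‖ ≤ c₂ Y_{k+1}` on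
`[τ k, τ (k+1)]` and the three level-`k+1` floors at `τ (k+1)` — give a registered stage of `S` at
every level (iterate `Stage.exists_extends_of_window_solution`). [cite: Sohr2001, Ch. V Thm. 1.5.1] -/
theorem nonempty_stage_of_window_solutions (hν : 0 < ν)
    (hs : Nonempty (Stage ν R S (Margins.routeG R) 0))
    (hW : ∀ (k : ℕ) (s : Stage ν R S (Margins.routeG R) k),
      ∃ ε : ℝ, 0 < ε ∧ ε ≤ S.τ k ∧
      ∃ (v : ℝ → EuclideanSpace ℝ (Fin 3) → EuclideanSpace ℝ (Fin 3))
        (q : ℝ → EuclideanSpace ℝ (Fin 3) → ℝ),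
        IsClassicalNSSolutionOn (Icc (S.τ k - ε) (S.τ (k + 1))) ν S.f v q ∧
        v (S.τ k - ε) = s.u (S.τ k - ε) ∧
        (∃ C : ℝ≥0∞, C < ⊤ ∧ ∀ t ∈ Icc (S.τ k - ε) (S.τ (k + 1)), ∫⁻ x, ‖v t x‖ₑ ^ 2 ≤ C) ∧
        (∀ t ∈ Icc (S.τ k) (S.τ (k + 1)), ∀ x, ‖v t x‖ ≤ S.c₂ * R.Y (k + 1)) ∧
        (∃ x, ‖x‖ ≤ S.radius ∧ S.c₁ * R.Y (k + 1) ≤ ‖v (S.τ (k + 1)) x‖) ∧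
        (∃ x, ‖x‖ ≤ S.radius ∧ S.c₁ * R.A (k + 1) ≤ ‖fderiv ℝ (v (S.τ (k + 1))) x‖) ∧
        (∃ (x : EuclideanSpace ℝ (Fin 3)) (γ : ℝ → EuclideanSpace ℝ (Fin 3)),
          ‖x‖ ≤ S.radius ∧ ContDiff ℝ 1 γ ∧ γ 0 = γ 1 ∧
          (∀ σ ∈ Icc (0 : ℝ) 1, γ σ ∈ Metric.closedBall x (1 / R.N (k + 1))) ∧
          (∀ σ ∈ Icc (0 : ℝ) 1, ‖deriv γ σ‖ ≤ 8 * π / R.N (k + 1)) ∧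
          S.c₁ * R.N (k + 1) ^ (R.β - 2) ≤ circulation (v (S.τ (k + 1))) γ))
    (K : ℕ) : Nonempty (Stage ν R S (Margins.routeG R) K) := by
  induction K with
  | zero => exact hs
  | succ K ih =>
    obtain ⟨s⟩ := ih
    obtain ⟨ε, hε, hεK, v, q, hcl, h0, henergy, hceil, hfloor, hstrain, hcore⟩ := hW K s
    obtain ⟨s', -⟩ :=
      s.exists_extends_of_window_solution hν hε hεK hcl h0 henergy hceil hfloor hstrain hcore
    exact ⟨s'⟩

end Schedule

/-- **Palasek's Step 2 from ONE design's window ladder** (any rates; conditional on the ladder,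
nothing asserted): p425922's `palasekStep2_of_nonempty_stages` fed by
`Schedule.nonempty_stage_of_window_solutions`. [cite: Palasek2026ElementaryModel, §4] -/
theorem palasekStep2_of_window_solutions {ν : ℝ} {R : TowerRates} (hν : 0 < ν) {S : Schedule R}
    (hs : Nonempty (Stage ν R S (Margins.routeG R) 0))
    (hW : ∀ (k : ℕ) (s : Stage ν R S (Margins.routeG R) k),
      ∃ ε : ℝ, 0 < ε ∧ ε ≤ S.τ k ∧
      ∃ (v : ℝ → EuclideanSpace ℝ (Fin 3) → EuclideanSpace ℝ (Fin 3))
        (q : ℝ → EuclideanSpace ℝ (Fin 3) → ℝ),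
        IsClassicalNSSolutionOn (Icc (S.τ k - ε) (S.τ (k + 1))) ν S.f v q ∧
        v (S.τ k - ε) = s.u (S.τ k - ε) ∧
        (∃ C : ℝ≥0∞, C < ⊤ ∧ ∀ t ∈ Icc (S.τ k - ε) (S.τ (k + 1)), ∫⁻ x, ‖v t x‖ₑ ^ 2 ≤ C) ∧
        (∀ t ∈ Icc (S.τ k) (S.τ (k + 1)), ∀ x, ‖v t x‖ ≤ S.c₂ * R.Y (k + 1)) ∧
        (∃ x, ‖x‖ ≤ S.radius ∧ S.c₁ * R.Y (k + 1) ≤ ‖v (S.τ (k + 1)) x‖) ∧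
        (∃ x, ‖x‖ ≤ S.radius ∧ S.c₁ * R.A (k + 1) ≤ ‖fderiv ℝ (v (S.τ (k + 1))) x‖) ∧
        (∃ (x : EuclideanSpace ℝ (Fin 3)) (γ : ℝ → EuclideanSpace ℝ (Fin 3)),
          ‖x‖ ≤ S.radius ∧ ContDiff ℝ 1 γ ∧ γ 0 = γ 1 ∧
          (∀ σ ∈ Icc (0 : ℝ) 1, γ σ ∈ Metric.closedBall x (1 / R.N (k + 1))) ∧
          (∀ σ ∈ Icc (0 : ℝ) 1, ‖deriv γ σ‖ ≤ 8 * π / R.N (k + 1)) ∧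
          S.c₁ * R.N (k + 1) ^ (R.β - 2) ≤ circulation (v (S.τ (k + 1))) γ)) :
    PalasekStep2 R :=
  palasekStep2_of_nonempty_stages hν (S.nonempty_stage_of_window_solutions hν hs hW)

/-- **Fefferman's (C) from ONE design's WINDOW LADDER** (any rates, any `ν > 0`; conditional on the
ladder — credits nothing, and the ladder is neither purchasable (ℝ³ enclosures at these floors) nor
asserted): a registered level-`0` stage of one design and, at every level, one window run from the
previous registered stage's own state with the next ceiling and the next floors give
`NavierStokesBreakdownR3` — the tower as a sequence of restarted initial-value runs, none re-running
the history (p425922's `navierStokesBreakdownR3_of_nonempty_stages`, i.e. the W14-free bridge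
`navierStokesBreakdownR3_of_step2_B`). [cite: FeffermanClay2006, (C)] -/
theorem navierStokesBreakdownR3_of_window_solutions {ν : ℝ} {R : TowerRates} (hν : 0 < ν)
    {S : Schedule R} (hs : Nonempty (Stage ν R S (Margins.routeG R) 0))
    (hW : ∀ (k : ℕ) (s : Stage ν R S (Margins.routeG R) k),
      ∃ ε : ℝ, 0 < ε ∧ ε ≤ S.τ k ∧
      ∃ (v : ℝ → EuclideanSpace ℝ (Fin 3) → EuclideanSpace ℝ (Fin 3))
        (q : ℝ → EuclideanSpace ℝ (Fin 3) → ℝ),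
        IsClassicalNSSolutionOn (Icc (S.τ k - ε) (S.τ (k + 1))) ν S.f v q ∧
        v (S.τ k - ε) = s.u (S.τ k - ε) ∧
        (∃ C : ℝ≥0∞, C < ⊤ ∧ ∀ t ∈ Icc (S.τ k - ε) (S.τ (k + 1)), ∫⁻ x, ‖v t x‖ₑ ^ 2 ≤ C) ∧
        (∀ t ∈ Icc (S.τ k) (S.τ (k + 1)), ∀ x, ‖v t x‖ ≤ S.c₂ * R.Y (k + 1)) ∧
        (∃ x, ‖x‖ ≤ S.radius ∧ S.c₁ * R.Y (k + 1) ≤ ‖v (S.τ (k + 1)) x‖) ∧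
        (∃ x, ‖x‖ ≤ S.radius ∧ S.c₁ * R.A (k + 1) ≤ ‖fderiv ℝ (v (S.τ (k + 1))) x‖) ∧
        (∃ (x : EuclideanSpace ℝ (Fin 3)) (γ : ℝ → EuclideanSpace ℝ (Fin 3)),
          ‖x‖ ≤ S.radius ∧ ContDiff ℝ 1 γ ∧ γ 0 = γ 1 ∧
          (∀ σ ∈ Icc (0 : ℝ) 1, γ σ ∈ Metric.closedBall x (1 / R.N (k + 1))) ∧
          (∀ σ ∈ Icc (0 : ℝ) 1, ‖deriv γ σ‖ ≤ 8 * π / R.N (k + 1)) ∧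
          S.c₁ * R.N (k + 1) ^ (R.β - 2) ≤ circulation (v (S.τ (k + 1))) γ)) :
    Summit.NavierStokesRegularity.NavierStokesRegularity.NavierStokesBreakdownR3 :=
  navierStokesBreakdownR3_of_nonempty_stages hν (S.nonempty_stage_of_window_solutions hν hs hW)

end Summit.NavierStokesRegularity.FluidComputer.PalasekTowerClayBridge

end
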